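import Literature.GroupTheory.SpecificGroups.PadicQuadraticAffineLevel
import HarnessLib

/-!
# The geometric vertex group `πR ⋊ U_ℝ` of the quadratic `p`-adic affine carrier is SLIM, and the
# geometric branch homomorphisms `U_ℝ → πR ⋊ U_ℝ` («torus centred at a real point»)

Topic `Literature/GroupTheory/SpecificGroups`; continues `PadicQuadraticOneUnits.lean` /
`PadicQuadraticAffineGroup.lean` / `PadicQuadraticAffineLevel.lean` (`R = ℤ_p[√p]`, `U = 1 + πR`, `U_ℝ`,
`G = R ⋊ (U_ℝ × U)`, `aug`, `act`, `stab`, `piLevel`):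

* `PadicQuadAffine.geomVertexGp p = piLevel p ⊓ ker aug = πR ⋊ U_ℝ` — the GEOMETRIC vertex group
  `{(a, w, 1) : a ∈ πR}`, a closed subgroup, compact as a topological group in its own right;
* `transl k = (pᵏ π, 1, 1)` and `scaling k = (0, 1 + pᵏ⁺¹, 1)` lie in it and tend to `1`;
* ★ `centralizer_eq_bot_of_isOpen` — **slimness** in the sense of [FrdI] §0 p. 13 / [SemiAnbd] Def 2.4 (ii):
  every open subgroup of `πR ⋊ U_ℝ` has trivial centraliser (an element commuting with `transl n` has linear
  part `1` because `R` is a domain, and one commuting with `scaling n` has `pⁿ⁺¹ · a = 0`, so `a = 0`);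
  contrast: the torsion variant `pℤ_p ⋊ μ_{p−1}` would NOT be slim (its open subgroup `pℤ_p` is abelian),
  which is why the real line must be the infinite group `1 + pℤ_p`;
* `geomBrHom y : U_ℝ →ₜ* πR ⋊ U_ℝ`, `w ↦ ((1 − w) y, w, 1)` for a REAL point `y` (`im y = 0`) — the
  geometric branch homomorphism «real scalings centred at `y`», continuous and injective, with range the
  geometric branch group `Stab(y) ∩ ker aug`.

(Elementary computations — OUR kernel check, no published claim asserted; the `[cite: …]` tags locate the
DEFINITIONS instantiated: slimness [SemiAnbd] §0 p. 6 / Def 2.4 (ii) p. 25, branches `b_* : Π_e → Π_v`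
Def 2.1 p. 22.)  Purpose (cell abc-iut, layer L3, row «NV-T54-RESIDUAL», stage-2a inputs after the stage-1
witness `Literature/AnabelianGeometry/SemiGraphs/ArithTotalEstrangementTransportWitness.lean`, design credit
abc-iut-w4-d029 gen 6 HANDOFF #2): the vertex group, edge group and branch maps of the loop graph of
anabelioids `𝓛′(p)` whose tempered chart is to map onto the compact carrier `G`.  Mathlib only; no statement
of any IUT paper is touched; no side taken on [IUTchIII] Cor 3.12.
-/

noncomputable section

namespace Literature.GroupTheory.SpecificGroups

open Topology Filter Set
open scoped QuadraticAlgebra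

variable (p : ℕ) [Fact p.Prime]

namespace PadicQuadOneUnits

variable {p}

/-- `realPow k = 1 + pᵏ⁺¹ → 1`. [cite: MochizukiSemiAnbd2006, §0, p. 6] -/
theorem tendsto_realPow : Tendsto (realPow (p := p)) atTop (𝓝 1) := by
  rw [isEmbedding_coord.isInducing.nhds_eq_comap, tendsto_comap_iff]
  have e : coord ∘ realPow (p := p) = fun k => ((1 : ℤ_[p]) + (p : ℤ_[p]) ^ (k + 1), (0 : ℤ_[p])) := by
    funext k; rfl
  rw [e, show coord (1 : PadicQuadOneUnits p) = (1, 0) from rfl]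
  refine Filter.Tendsto.prodMk_nhds ?_ tendsto_const_nhds
  have h0 : Tendsto (fun k : ℕ => (p : ℤ_[p]) ^ (k + 1)) atTop (𝓝 0) := by
    refine (tendsto_pow_atTop_nhds_zero_of_norm_lt_one ?_).comp (tendsto_add_atTop_nat 1)
    rw [PadicInt.norm_p]
    exact inv_lt_one_of_one_lt₀ (by exact_mod_cast (Fact.out : p.Prime).one_lt)
  simpa using tendsto_const_nhds.add h0

/-- The real line `U_ℝ` is compact (a closed subgroup of the compact `U`). [cite: MochizukiSemiAnbd2006, §0, p. 6] -/
instance : CompactSpace (real p) := isCompact_iff_compactSpace.mp (isClosed_real (p := p)).isCompact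

end PadicQuadOneUnits

namespace PadicQuadAffine

variable {p}

open PadicQuadOneUnits

variable (p) in
/-- The GEOMETRIC vertex group `πR ⋊ U_ℝ = piLevel ⊓ ker aug = {(a, w, 1) : a ∈ πR}`.
[cite: MochizukiSemiAnbd2006, Def 5.3 (iii), p. 65] -/
def geomVertexGp : Subgroup (PadicQuadAffine p) := piLevel p ⊓ aug.ker

/-- Membership in the geometric vertex group. [cite: MochizukiSemiAnbd2006, Def 5.3 (iii), p. 65] -/
@[simp] theorem mem_geomVertexGp_iff (g : PadicQuadAffine p) : g ∈ geomVertexGp p ↔ ‖g.a.re‖ < 1 ∧ g.u = 1 :=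
  Iff.rfl

/-- The geometric vertex group is closed. [cite: MochizukiSemiAnbd2006, Def 5.3 (iii), p. 65] -/
theorem isClosed_geomVertexGp : IsClosed (geomVertexGp p : Set (PadicQuadAffine p)) := by
  have e : (geomVertexGp p : Set (PadicQuadAffine p)) = (piLevel p : Set (PadicQuadAffine p)) ∩ {g | g.u = 1} := by
    ext g; simp
  rw [e]
  exact isClosed_piLevel.inter (isClosed_eq continuous_u continuous_const)

/-- The geometric vertex group is compact in its own right. [cite: MochizukiSemiAnbd2006, Def 5.3 (iii), p. 65] -/
instance : CompactSpace (geomVertexGp p) :=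
  isCompact_iff_compactSpace.mp (isClosed_geomVertexGp (p := p)).isCompact

/-- The translation `t_k = (pᵏ π, 1, 1)`. [cite: MochizukiSemiAnbd2006, §0, p. 6] -/
def transl (k : ℕ) : PadicQuadAffine p := ⟨⟨0, (p : ℤ_[p]) ^ k⟩, 1, 1, QuadraticAlgebra.im_one⟩

/-- The real scaling `s_k = (0, 1 + pᵏ⁺¹, 1)`. [cite: MochizukiSemiAnbd2006, §0, p. 6] -/
def scaling (k : ℕ) : PadicQuadAffine p := ⟨0, realPow k, 1, realPow_mem_real k⟩

/-- `t_k` lies in the geometric vertex group. [cite: MochizukiSemiAnbd2006, §0, p. 6] -/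
@[simp] theorem transl_mem (k : ℕ) : transl (p := p) k ∈ geomVertexGp p := by simp [transl]

/-- `s_k` lies in the geometric vertex group. [cite: MochizukiSemiAnbd2006, §0, p. 6] -/
@[simp] theorem scaling_mem (k : ℕ) : scaling (p := p) k ∈ geomVertexGp p := by simp [scaling]

/-- `t_k → 1`. [cite: MochizukiSemiAnbd2006, §0, p. 6] -/
theorem tendsto_transl : Tendsto (transl (p := p)) atTop (𝓝 1) := by
  rw [isEmbedding_coord.isInducing.nhds_eq_comap, tendsto_comap_iff]
  have e : coord ∘ transl (p := p) = fun k => (((0 : ℤ_[p]), (p : ℤ_[p]) ^ k), ((1 : PadicQuadOneUnits p), (1 : PadicQuadOneUnits p))) := by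
    funext k; rfl
  rw [e, show coord (1 : PadicQuadAffine p) = ((0, 0), (1, 1)) from rfl]
  refine (tendsto_const_nhds.prodMk_nhds ?_).prodMk_nhds tendsto_const_nhds
  refine tendsto_pow_atTop_nhds_zero_of_norm_lt_one ?_
  rw [PadicInt.norm_p]
  exact inv_lt_one_of_one_lt₀ (by exact_mod_cast (Fact.out : p.Prime).one_lt)

/-- `s_k → 1`. [cite: MochizukiSemiAnbd2006, §0, p. 6] -/
theorem tendsto_scaling : Tendsto (scaling (p := p)) atTop (𝓝 1) := by
  rw [isEmbedding_coord.isInducing.nhds_eq_comap, tendsto_comap_iff]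
  have e : coord ∘ scaling (p := p) = fun k => (((0 : ℤ_[p]), (0 : ℤ_[p])), (realPow k, (1 : PadicQuadOneUnits p))) := by
    funext k; rfl
  rw [e, show coord (1 : PadicQuadAffine p) = ((0, 0), (1, 1)) from rfl]
  exact tendsto_const_nhds.prodMk_nhds (tendsto_realPow.prodMk_nhds tendsto_const_nhds)

/-- An element of the geometric vertex group commuting with some `t_n` and some `s_m` is trivial:
`(lin g − 1)·pⁿπ = 0` forces `lin g = w = 1` (domain), then `pᵐ⁺¹ · a = 0` forces `a = 0`.
[cite: MochizukiSemiAnbd2006, Def 2.4 (ii), p. 25] -/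
theorem eq_one_of_commute_transl_scaling {g : PadicQuadAffine p} (hg : g ∈ geomVertexGp p) (n m : ℕ)
    (ht : transl n * g = g * transl n) (hs : scaling m * g = g * scaling m) : g = 1 := by
  obtain ⟨-, hu⟩ := (mem_geomVertexGp_iff g).mp hg
  have hp0 : (p : ℤ_[p]) ≠ 0 := PadicInt.irreducible_p.ne_zero
  -- the translation test: `lin g = 1`
  have h1 := congrArg PadicQuadAffine.a ht
  simp only [transl, mul_a, lin, PadicQuadOneUnits.val_one, mul_one, one_mul] at h1
  have hl : g.w.val * g.u.val = 1 := by
    refine PadicQuad.eq_one_of_sub_one_mul_eq_zero (c := ⟨0, (p : ℤ_[p]) ^ n⟩) ?_ ?_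
    · linear_combination -h1
    · simp [QuadraticAlgebra.ext_iff, hp0]
  have hw : g.w = 1 := by
    apply PadicQuadOneUnits.ext
    simpa [hu] using hl
  -- the scaling test: `a = 0`
  have h2 := congrArg PadicQuadAffine.a hs
  simp only [scaling, mul_a, lin, PadicQuadOneUnits.val_one, mul_one, mul_zero, add_zero, zero_add] at h2
  have h3 : (algebraMap ℤ_[p] (PadicQuad p) ((p : ℤ_[p]) ^ (m + 1))) * g.a = 0 := by
    have e : (realPow (p := p) m).val = 1 + algebraMap ℤ_[p] (PadicQuad p) ((p : ℤ_[p]) ^ (m + 1)) := by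
      ext <;> simp [realPow, QuadraticAlgebra.algebraMap_eq]
    rw [e] at h2
    linear_combination h2
  have ha : g.a = 0 := by
    rcases (PadicQuad.mul_eq_zero_iff _ _).mp h3 with h | h
    · exfalso
      have := congrArg QuadraticAlgebra.re h
      simp only [QuadraticAlgebra.algebraMap_eq, QuadraticAlgebra.re_zero] at this
      exact pow_ne_zero _ hp0 this
    · exact h
  ext1
  · exact ha
  · exact hw
  · exact hu

/-- An open subgroup of the geometric vertex group contains `t_k` and `s_k` for all large `k`.
[cite: MochizukiSemiAnbd2006, Def 2.4 (ii), p. 25] -/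
theorem exists_transl_scaling_mem (H : Subgroup (geomVertexGp p)) (hH : IsOpen (H : Set (geomVertexGp p))) :
    ∃ k, (⟨transl k, transl_mem k⟩ : geomVertexGp p) ∈ H ∧ (⟨scaling k, scaling_mem k⟩ : geomVertexGp p) ∈ H := by
  have ht : Tendsto (fun k => (⟨transl k, transl_mem k⟩ : geomVertexGp p)) atTop (𝓝 1) := by
    rw [nhds_subtype_eq_comap, tendsto_comap_iff]
    exact tendsto_transl
  have hs : Tendsto (fun k => (⟨scaling k, scaling_mem k⟩ : geomVertexGp p)) atTop (𝓝 1) := by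
    rw [nhds_subtype_eq_comap, tendsto_comap_iff]
    exact tendsto_scaling
  have h1 : (1 : geomVertexGp p) ∈ (H : Set (geomVertexGp p)) := H.one_mem
  obtain ⟨N₁, hN₁⟩ := Filter.eventually_atTop.mp (ht.eventually (hH.mem_nhds h1))
  obtain ⟨N₂, hN₂⟩ := Filter.eventually_atTop.mp (hs.eventually (hH.mem_nhds h1))
  exact ⟨max N₁ N₂, hN₁ _ (le_max_left _ _), hN₂ _ (le_max_right _ _)⟩

/-- ★ **The geometric vertex group `πR ⋊ U_ℝ` is SLIM**: the centraliser of every open subgroup is trivial.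
[cite: MochizukiSemiAnbd2006, Def 2.4 (ii), p. 25] -/
theorem centralizer_eq_bot_of_isOpen (H : Subgroup (geomVertexGp p)) (hH : IsOpen (H : Set (geomVertexGp p))) :
    Subgroup.centralizer (H : Set (geomVertexGp p)) = ⊥ := by
  rw [eq_bot_iff]
  intro g hg
  rw [Subgroup.mem_centralizer_iff] at hg
  obtain ⟨k, htk, hsk⟩ := exists_transl_scaling_mem H hH
  have ht := congrArg Subtype.val (hg _ htk)
  have hs := congrArg Subtype.val (hg _ hsk)
  simp only [Subgroup.coe_mul] at ht hs
  rw [Subgroup.mem_bot]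
  exact Subtype.ext (eq_one_of_commute_transl_scaling g.2 k k ht hs)

/-- The centre of the geometric vertex group is trivial. [cite: MochizukiSemiAnbd2006, Def 2.4 (ii), p. 25] -/
theorem center_eq_bot : Subgroup.center (geomVertexGp p) = ⊥ := by
  rw [eq_bot_iff]
  intro g hg
  have := centralizer_eq_bot_of_isOpen (⊤ : Subgroup (geomVertexGp p)) (by simp)
  rw [eq_bot_iff] at this
  exact this (by
    rw [Subgroup.mem_centralizer_iff]
    intro h _
    exact ((Subgroup.mem_center_iff.mp hg) h))

/-! ### The geometric branch homomorphisms `U_ℝ → πR ⋊ U_ℝ` -/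

/-- The element `((1 − w) y, w, 1)` — the real scaling `w` centred at the point `y`.
[cite: MochizukiSemiAnbd2006, Def 2.1, p. 22] -/
def brElt (y : PadicQuad p) (w : real p) : PadicQuadAffine p :=
  ⟨(1 - (w : PadicQuadOneUnits p).val) * y, w, 1, w.2⟩

/-- `brElt y w` fixes `y`, with trivial arithmetic part. [cite: MochizukiSemiAnbd2006, Def 2.1, p. 22] -/
theorem brElt_mem_stab_inf_ker (y : PadicQuad p) (w : real p) : brElt y w ∈ stab y ⊓ aug.ker := by
  refine Subgroup.mem_inf.mpr ⟨?_, ?_⟩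
  · rw [mem_stab_iff]
    simp only [act, brElt, lin, PadicQuadOneUnits.val_one, mul_one]
    ring
  · rw [MonoidHom.mem_ker]
    rfl

/-- `brElt y w` lies in the geometric vertex group. [cite: MochizukiSemiAnbd2006, Def 2.1, p. 22] -/
theorem brElt_mem (y : PadicQuad p) (w : real p) : brElt y w ∈ geomVertexGp p :=
  ⟨stab_le_piLevel y (brElt_mem_stab_inf_ker y w).1, (brElt_mem_stab_inf_ker y w).2⟩

/-- `brElt y` is multiplicative. [cite: MochizukiSemiAnbd2006, Def 2.1, p. 22] -/
theorem brElt_mul (y : PadicQuad p) (w w' : real p) : brElt y (w * w') = brElt y w * brElt y w' := by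
  ext1
  · simp only [brElt, mul_a, lin, Subgroup.coe_mul, PadicQuadOneUnits.val_mul, PadicQuadOneUnits.val_one,
      mul_one]
    ring
  · rfl
  · simp [brElt]

/-- **The geometric branch homomorphism** `U_ℝ →ₜ* πR ⋊ U_ℝ`, `w ↦ ((1 − w) y, w, 1)` (real scalings centred
at `y`). [cite: MochizukiSemiAnbd2006, Def 2.1, p. 22] -/
def geomBrHom (y : PadicQuad p) : real p →ₜ* geomVertexGp p where
  toFun w := ⟨brElt y w, brElt_mem y w⟩
  map_one' := Subtype.ext (by ext1 <;> simp [brElt])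
  map_mul' w w' := Subtype.ext (brElt_mul y w w')
  continuous_toFun := by
    refine Continuous.subtype_mk ?_ _
    have hw : Continuous fun w : real p => (w : PadicQuadOneUnits p) := continuous_subtype_val
    apply continuous_of_coord
    · simp only [brElt]
      exact PadicQuad.continuous_re_mul (by
          simp only [QuadraticAlgebra.re_sub, QuadraticAlgebra.re_one]
          exact continuous_const.sub (PadicQuadOneUnits.continuous_re.comp hw))
        (by
          simp only [QuadraticAlgebra.im_sub, QuadraticAlgebra.im_one]
          exact continuous_const.sub (PadicQuadOneUnits.continuous_im.comp hw))
        continuous_const continuous_const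
    · simp only [brElt]
      exact PadicQuad.continuous_im_mul (by
          simp only [QuadraticAlgebra.re_sub, QuadraticAlgebra.re_one]
          exact continuous_const.sub (PadicQuadOneUnits.continuous_re.comp hw))
        (by
          simp only [QuadraticAlgebra.im_sub, QuadraticAlgebra.im_one]
          exact continuous_const.sub (PadicQuadOneUnits.continuous_im.comp hw))
        continuous_const continuous_const
    · exact hw
    · exact continuous_const

/-- Value of the geometric branch homomorphism. [cite: MochizukiSemiAnbd2006, Def 2.1, p. 22] -/
@[simp] theorem coe_geomBrHom (y : PadicQuad p) (w : real p) : (geomBrHom y w : PadicQuadAffine p) = brElt y w := rfl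

/-- The geometric branch homomorphism is injective. [cite: MochizukiSemiAnbd2006, Def 2.1, p. 22] -/
theorem geomBrHom_injective (y : PadicQuad p) : Function.Injective (geomBrHom (p := p) y) := by
  intro w w' h
  have := congrArg (fun g : geomVertexGp p => (g : PadicQuadAffine p).w) h
  exact Subtype.ext (by simpa [brElt] using this)

/-- The range of the geometric branch homomorphism, pushed into `G`, is the geometric branch group
`Stab(y) ∩ ker aug`. [cite: MochizukiSemiAnbd2006, Def 5.3 (iii), p. 65] -/
theorem map_range_geomBrHom (y : PadicQuad p) :
    (geomBrHom (p := p) y).toMonoidHom.range.map (geomVertexGp p).subtype = stab y ⊓ aug.ker := by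
  ext g
  simp only [Subgroup.mem_map, MonoidHom.mem_range, Subgroup.coe_subtype, ContinuousMonoidHom.coe_toMonoidHom,
    exists_exists_eq_and]
  constructor
  · rintro ⟨w, rfl⟩
    exact brElt_mem_stab_inf_ker y w
  · intro hg
    obtain ⟨hy, hu⟩ := Subgroup.mem_inf.mp hg
    rw [MonoidHom.mem_ker, aug_apply] at hu
    rw [mem_stab_iff] at hy
    simp only [act, lin, hu, PadicQuadOneUnits.val_one, mul_one] at hy
    refine ⟨⟨g.w, g.w_real⟩, ?_⟩
    show brElt y ⟨g.w, g.w_real⟩ = g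
    ext1
    · simp only [brElt]
      linear_combination -hy
    · rfl
    · simp [brElt, hu]

end PadicQuadAffine

end Literature.GroupTheory.SpecificGroups
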